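import Summits.MatrixMultiplication.MatrixMultiplication.Theorems.FarEdgeDescentTower
import Summits.MatrixMultiplication.MatrixMultiplication.Theorems.FarEdgeDescentGlue
import Summits.MatrixMultiplication.MatrixMultiplication.Theorems.FarEdgeDescentPowerCeiling
import HarnessLib

/-!
# Route `FarEdgeDescent` — after `PowerAmortisation`: the special leaf IS its remaining child
(lens-2 «special vs generic», gen 48; support module for the open split child `OctaveFlatness`
stmt-MatrixMultiplication-25348 of the special leaf `FiniteSaturation` stmt-23739; def-free; cut of record
`closes (h₁ : FiniteSaturation) (h₂ : AnchoredLogConvexity)` UNCHANGED)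

Gen 48 proved the split child `PowerAmortisation` (stmt-25347) outright
(`FarEdgeDescentPowerAmortisation.powerAmortisation` = `FarEdgeDescentTower.powerAmortisation_bound ℂ`, the route-free
form used below: `ω(1,k,1) − (k+1) ≤ 3·k^(−1/4)` for every integer `k ≥ 1`, from the border-rank tower).  Consequences for the cone, as theorems:

* `finiteSaturation_iff_octaveFlatness` — the exact split `FiniteSaturation ⟺ PowerAmortisation ∧ OctaveFlatness`
  (glue stmt-25349, `FarEdgeDescentGlue.finiteSaturationGlue`) collapses: the special leaf is now EQUIVALENT to its
  one remaining open child `OctaveFlatness` (slow variation of the excess along octaves).  The converse direction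
  `octaveFlatness_of_finiteSaturation` (finite saturation ⟹ the excess vanishes from the anchor on, by the
  Lotti–Romani monotonicity `omegaRect_one_mid_one_sub_antitone` and the information bound) was so far only a
  lens-draft kernel; it is landed here.
* `matrixMultiplication_of_octaveFlatness` — hence the route's deciding theorem reads, by theorem,
  `OctaveFlatness → AnchoredLogConvexity → ω = 2` (no route edit: `closes` composed with the equivalence).
* `omegaRect_lt_firstPower` — gen 42's conditional placement
  (`FarEdgeDescentPowerCeiling.omegaRect_lt_firstPower_of_powerAmortisation`) now fires UNCONDITIONALLY: eventually
  in `k` the true profile `ω(1,k,1)` lies strictly below the value of every instance `(q ≥ 2, σ, ρ)` of the full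
  first-power Coppersmith–Winograd certificate `cwFullFirstPowerValue` — the far edge of the TRUE exponent profile is
  outside the first-power CW class, by theorem and without hypotheses.
[cite: LottiRomani1983, §2, Prop. 4.1] [cite: CoppersmithWinograd1990, §§6–7]
-/

set_option linter.dupNamespace false

noncomputable section

namespace Summit.MatrixMultiplication.MatrixMultiplication.Theorems.FarEdgeDescentSpecialLeafReduction

open Literature.Computability.AlgebraicComplexity
open Summit.MatrixMultiplication.MatrixMultiplication.Theses.FarEdgeDescent
open Summit.MatrixMultiplication.MatrixMultiplication.Theorems

/-- **`OctaveFlatness ⟹ FiniteSaturation`** — the glue `PowerAmortisation → OctaveFlatness → FiniteSaturation`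
(stmt-25349) fed with the now-proved `PowerAmortisation`. -/
theorem finiteSaturation_of_octaveFlatness (h : OctaveFlatness) : FiniteSaturation :=
  FarEdgeDescentGlue.finiteSaturationGlue (FarEdgeDescentTower.powerAmortisation_bound ℂ) h

/-- **`FiniteSaturation ⟹ OctaveFlatness`**: if `ω(1,β,1) = β + 1` for some integer `β ≥ 2` then the excess
`e(k) = ω(1,k,1) − (k+1)` vanishes for every `k ≥ β` (it is non-increasing — Lotti–Romani — and non-negative), so
`e(k) ≤ l · e(2k)` holds from `β` on for every `l > 1` (indeed for every `l ≥ 0`). -/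
theorem octaveFlatness_of_finiteSaturation (h : FiniteSaturation) : OctaveFlatness := by
  obtain ⟨β, hβ, hzero⟩ := h
  intro l hl
  refine ⟨β, le_trans (by norm_num) hβ, fun k hk => ?_⟩
  have hcast : (β : ℝ) ≤ k := by exact_mod_cast hk
  have hanti := omegaRect_one_mid_one_sub_antitone ℂ hcast
  dsimp only at hanti
  have h2k : 0 ≤ omegaRect ℂ 1 (2 * (k : ℝ)) 1 - (2 * (k : ℝ) + 1) := FarEdgeDescentGlue.excess_nonneg _
  have hl0 : 0 ≤ l := le_trans zero_le_one hl.le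
  nlinarith [mul_nonneg hl0 h2k]

/-- **The special leaf is equivalent to its remaining open child** (gen-1 split after gen 48). -/
theorem finiteSaturation_iff_octaveFlatness : FiniteSaturation ↔ OctaveFlatness :=
  ⟨octaveFlatness_of_finiteSaturation, finiteSaturation_of_octaveFlatness⟩

/-- The route's deciding theorem, read through the equivalence: **`OctaveFlatness → AnchoredLogConvexity → ω = 2`**. -/
theorem matrixMultiplication_of_octaveFlatness (h₁ : OctaveFlatness) (h₂ : AnchoredLogConvexity) :
    _root_.MatrixMultiplication :=
  closes (finiteSaturation_of_octaveFlatness h₁) h₂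

/-- **Unconditionally: the far edge of the true profile lies strictly below the whole first-power CW class.**
Eventually in `k`, `ω(1,k,1) < cwFullFirstPowerValue q k σ ρ` for every `q ≥ 2`, `σ, ρ ≥ 0`, `2σ + ρ < 1`
(gen 42's `omegaRect_lt_firstPower_of_powerAmortisation` discharged by gen 48's `powerAmortisation`).
[cite: CoppersmithWinograd1990, §§6–7] -/
theorem omegaRect_lt_firstPower :
    ∃ k₀ : ℕ, 2 ≤ k₀ ∧ ∀ k : ℕ, k₀ ≤ k → ∀ q : ℕ, 2 ≤ q → ∀ σ ρ : ℝ, 0 ≤ σ → 0 ≤ ρ → 2 * σ + ρ < 1 →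
      omegaRect ℂ 1 k 1 < FarEdgeDescentLogRate.cwFullFirstPowerValue q k σ ρ :=
  FarEdgeDescentPowerCeiling.omegaRect_lt_firstPower_of_powerAmortisation
    (FarEdgeDescentTower.powerAmortisation_bound ℂ)

end Summit.MatrixMultiplication.MatrixMultiplication.Theorems.FarEdgeDescentSpecialLeafReduction

end
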